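import Mathlib.RingTheory.Artinian.Module
import Literature.NumberTheory.ComplexMultiplication.CMTypeTraceModule
import HarnessLib

/-!
# A `k`-linear action of a CM algebra is determined by its traces (Milne, *Complex Multiplication*,
# Ch. I §1 Prop. 1.21, the uniqueness clause for CM ALGEBRAS)

Layer `Literature/NumberTheory/ComplexMultiplication`.  Theorems only; no definition, no named fact (D-0026, net
debt 0).  Sibling of `CMTypeTraceModule` (Prop. 1.21 existence iff `k ⊇ E*`, Cor. 1.22, and uniqueness for a CM
FIELD), which it completes by the uniqueness clause for an arbitrary CM ALGEBRA `E`.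

THE PRINT.  J. S. Milne, *Complex Multiplication* (course notes) [MilneCM2006], Ch. I §1 «The reflex norm»,
Proposition 1.21, p. 15 of the version of July 14, 2020 (read 2026-08-21 as `paper:url-8ccc30e4daab` p0015):

> «PROPOSITION 1.21 Let `(E, Φ)` be a CM-pair, and let `k` be a subfield of `ℚ̄`.  There exists a finitely
> generated `E ⊗_ℚ k`-module `V` such that `Tr_k(a|V) = Σ_{φ∈Φ} φ(a)`, all `a ∈ E`, (5) if and only if `k ⊇ E*`,
> in which case `V` is uniquely determined up to an `E ⊗_ℚ k`-isomorphism.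
> PROOF. […] There is then a canonical isomorphism `e ⊗ a ↦ (φ(e)a)_φ : E ⊗_ℚ k → ∏_{φ : E → k} k_φ`, and so any
> `E ⊗_ℚ k`-module `V` is of the form `⊕_φ m_φ k_φ` for unique nonnegative integers `m_φ` […]. Thus, up to
> isomorphism, there exists exactly one `E ⊗_ℚ k`-module satisfying (5) […] Any `E ⊗_ℚ k`-module satisfying (5)
> becomes isomorphic to `⊕_{φ∈Φ} Ω_φ` over `Ω`, and so this shows that, up to isomorphism, there exists exactly
> one such `E ⊗_ℚ k`-module.»

SETTING (as in `CMTypeTraceModule`).  `E` a commutative `ℚ`-algebra, finite over `ℚ` and REDUCED — every CM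
algebra `E ≅ ∏ Kᵢ` is (`IsCMAlgebra.moduleFinite`, `IsCMAlgebra.isReduced`) —, `k` a field of characteristic `0`,
an «`E ⊗_ℚ k`-module» a finite-dimensional `k`-space `V` with `ρ : E →+* Module.End k V`, an
«`E ⊗_ℚ k`-isomorphism» a `k`-linear equivalence commuting with the actions.

WHAT IS PROVED (a semisimplicity argument replacing the printed passage through `Ω ⊇ k`; the printed mechanism
«any `E ⊗_ℚ k`-module is `⊕ m_φ k_φ`» is the semisimplicity of `E ⊗_ℚ k`-modules).
* §1 `ringHom_apply_isSemisimple`: each `ρ(a)` is a semisimple endomorphism — it is killed by the minimal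
  polynomial of `a` over `ℚ`, square-free since `E` is reduced (Mathlib `minpoly.isRadical`,
  `Module.End.isSemisimple_of_squarefree_aeval_eq_zero`).
* §2 `isSemisimpleRepresentation_toMonoidHom`: **the action is semisimple** — every `E`-stable subspace has an
  `E`-stable complement.  The commutative `k`-algebra `B = k[ρ(E)] ⊆ End_k(V)` consists of semisimple
  endomorphisms (sums/products of commuting semisimple endomorphisms over a perfect field, Mathlib
  `Module.End.IsSemisimple.add_of_commute`), hence is reduced; reduced Artinian ⇒ semisimple ring (Mathlib
  `IsArtinianRing.isSemisimpleRing_of_isReduced`), so `V` is a semisimple `B`-module, and the `B`-submodules are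
  the `E`-stable subspaces.
* §3 **PROPOSITION 1.21, uniqueness clause** `exists_equiv_of_trace_eq_of_isReduced` /
  `exists_equiv_of_trace_eq_of_isCMAlgebra`: equal traces ⇒ `E ⊗_ℚ k`-isomorphic, by Bourbaki, *Algèbre* VIII §20
  n°6 Cor. a) of Prop. 6 for semisimple representations of the multiplicative monoid of `E` (the tree's
  `RepresentationTheory.Semisimple.Representation.nonempty_equiv_of_character_eq_of_isSemisimple`); in the
  vocabulary of (5): `exists_equiv_of_trace_eq_cmTraceOn`, and over a number field `k ⊇ E*` every solution of (5)
  is isomorphic to the model `V_Φ = traceModule Φ k` (`exists_equiv_traceModule`).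

## References
* [MilneCM2006] J. S. Milne, *Complex Multiplication* (course notes; version July 14, 2020), Ch. I §1 Prop. 1.21
  (uniqueness clause) and its proof (p. 15).
* [BourbakiAlgebreVIII2012] N. Bourbaki, *Algèbre, Ch. VIII* (2ᵉ éd. 2012), §20 n°6, Cor. a) de la Prop. 6 (used
  through the tree).
* [GaoUllmo2025] Z. Gao, E. Ullmo, J. Inst. Math. Jussieu 25 (2025), §2.1 (CM algebras; the carrier).

## Provenance

Lane `lit-hodgefound` (Hodge path, Track 2, Layer A3), prover seat `lit-hodgefound-p27` (generation 3); sibling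
(theorems only) of row Q185 `CMTypeTraceModule` (p256164).
-/

set_option autoImplicit false

noncomputable section

open scoped Polynomial

namespace Literature.NumberTheory.ComplexMultiplication

open Literature.AlgebraicGeometry.GaoUllmo2025
open Module
open Polynomial (aeval aeval_map_algebraMap aeval_algHom_apply)

/-! ## §1 Each `ρ(a)` is a semisimple endomorphism -/

section Semisimple

variable {E : Type} [CommRing E] [Algebra ℚ E] [Module.Finite ℚ E]
variable {k : Type} [Field k] [CharZero k]
variable {V : Type} [AddCommGroup V] [Module k V]

/-- For `E` a reduced finite commutative `ℚ`-algebra (e.g. a CM algebra `∏ Kᵢ`) and a `k`-linear action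
`ρ` of `E` (`char k = 0`), every `ρ(a)` is a semisimple endomorphism: it is killed by the minimal polynomial of
`a` over `ℚ`, which is square-free because `E` is reduced. [cite: MilneCM2006, Ch. I §1 Prop. 1.21 (proof)] -/
theorem ringHom_apply_isSemisimple [IsReduced E] (ρ : E →+* Module.End k V) (a : E) : (ρ a).IsSemisimple := by
  letI : Module ℚ V := Module.compHom V (algebraMap ℚ k)
  haveI : IsScalarTower ℚ k V := ⟨fun q c v => by
    change (q • c) • v = algebraMap ℚ k q • (c • v)
    rw [Algebra.smul_def, mul_smul]⟩
  let ρ' : E →ₐ[ℚ] Module.End k V := ρ.toRatAlgHom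
  have hint : IsIntegral ℚ a := Algebra.IsIntegral.isIntegral a
  have hsq : Squarefree (minpoly ℚ a) := (minpoly.isRadical ℚ a).squarefree (minpoly.ne_zero hint)
  have hsep : (minpoly ℚ a).Separable := PerfectField.separable_iff_squarefree.2 hsq
  have hμ : Squarefree ((minpoly ℚ a).map (algebraMap ℚ k)) := hsep.map.squarefree
  refine Module.End.isSemisimple_of_squarefree_aeval_eq_zero hμ ?_
  change aeval (ρ' a) ((minpoly ℚ a).map (algebraMap ℚ k)) = 0
  rw [aeval_map_algebraMap, aeval_algHom_apply, minpoly.aeval, map_zero]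

/-! ## §2 The action is semisimple: `E`-stable subspaces have `E`-stable complements -/

omit [Algebra ℚ E] [Module.Finite ℚ E] [CharZero k] in
/-- The `k`-subalgebra of `End_k(V)` generated by `ρ(E)` is commutative.
[cite: MilneCM2006, Ch. I §1 Prop. 1.21 (proof)] -/
theorem commute_of_mem_adjoin_range_ringHom (ρ : E →+* Module.End k V) {x y : Module.End k V}
    (hx : x ∈ Algebra.adjoin k (Set.range ρ)) (hy : y ∈ Algebra.adjoin k (Set.range ρ)) : Commute x y := by
  have hgen : ∀ z ∈ Algebra.adjoin k (Set.range ρ), ∀ g ∈ Set.range ρ, Commute g z := by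
    intro z hz g hg
    refine Algebra.commute_of_mem_adjoin_of_forall_mem_commute hz fun g' hg' => ?_
    obtain ⟨a, rfl⟩ := hg
    obtain ⟨b, rfl⟩ := hg'
    change ρ a * ρ b = ρ b * ρ a
    rw [← map_mul, mul_comm, map_mul]
  exact Algebra.commute_of_mem_adjoin_of_forall_mem_commute hy fun g hg => (hgen x hx g hg).symm

/-- Every element of the `k`-algebra `k[ρ(E)] ⊆ End_k(V)` is semisimple (sums and products of commuting semisimple
endomorphisms over a perfect field, Mathlib `Module.End.IsSemisimple.add_of_commute` / `mul_of_commute`).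
[cite: MilneCM2006, Ch. I §1 Prop. 1.21 (proof)] -/
theorem isSemisimple_of_mem_adjoin_range_ringHom [IsReduced E] [FiniteDimensional k V] (ρ : E →+* Module.End k V) {x : Module.End k V}
    (hx : x ∈ Algebra.adjoin k (Set.range ρ)) : x.IsSemisimple := by
  induction hx using Algebra.adjoin_induction with
  | mem x hx =>
    obtain ⟨a, rfl⟩ := hx
    exact ringHom_apply_isSemisimple ρ a
  | algebraMap c =>
    rw [Algebra.algebraMap_eq_smul_one]
    exact Module.End.IsSemisimple_smul c Module.End.isSemisimple_id
  | add x y hx hy hx' hy' =>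
    exact Module.End.IsSemisimple.add_of_commute (commute_of_mem_adjoin_range_ringHom ρ hx hy) hx' hy'
  | mul x y hx hy hx' hy' =>
    exact Module.End.IsSemisimple.mul_of_commute (commute_of_mem_adjoin_range_ringHom ρ hx hy) hx' hy'

/-- **The `k`-linear action of `E` on `V` is semisimple**: every `E`-stable `k`-subspace has an `E`-stable
complement (the representation of the multiplicative monoid of `E` on `V` is semisimple).  Proof: the commutative
`k`-algebra `B = k[ρ(E)] ⊆ End_k(V)` consists of semisimple endomorphisms, hence is reduced; a reduced Artinian
commutative ring is semisimple, so `V` is a semisimple `B`-module, and `B`-submodules are exactly the `E`-stable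
subspaces.  (In the printed proof: `E ⊗_ℚ k ≅ ∏ k_φ` when `k` contains all conjugates of `E`, «and so any
`E ⊗_ℚ k`-module `V` is of the form `⊕_φ m_φ k_φ`».) [cite: MilneCM2006, Ch. I §1 Prop. 1.21 (proof)] -/
theorem isSemisimpleRepresentation_toMonoidHom [IsReduced E] [FiniteDimensional k V] (ρ : E →+* Module.End k V) :
    Representation.IsSemisimpleRepresentation (ρ.toMonoidHom : Representation k E V) := by
  classical
  set S : Set (Module.End k V) := Set.range ρ with hS
  have hcomm : ∀ x ∈ S, ∀ y ∈ S, x * y = y * x := by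
    rintro _ ⟨a, rfl⟩ _ ⟨b, rfl⟩
    rw [← map_mul, mul_comm, map_mul]
  let B : Subalgebra k (Module.End k V) := Algebra.adjoin k S
  -- `B` is a reduced Artinian commutative ring, hence semisimple
  haveI := Algebra.isMulCommutative_adjoin k hcomm
  letI : CommRing B := open scoped IsMulCommutative in inferInstance
  haveI : IsReduced B := ⟨fun b hb => by
    obtain ⟨n, hn⟩ := hb
    have hnil : IsNilpotent (b : Module.End k V) := ⟨n, by rw [← SubmonoidClass.coe_pow, hn]; rfl⟩
    exact Subtype.ext (Module.End.eq_zero_of_isNilpotent_isSemisimple hnil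
      (isSemisimple_of_mem_adjoin_range_ringHom ρ b.2))⟩
  haveI : Module.Finite k B := FiniteDimensional.of_injective B.val.toLinearMap Subtype.val_injective
  haveI : IsArtinianRing B := IsArtinianRing.of_finite k B
  haveI : IsSemisimpleRing B := IsArtinianRing.isSemisimpleRing_of_isReduced B
  haveI : IsScalarTower k B V := ⟨fun c b v => by
    change ((c • b : B) : Module.End k V) v = c • ((b : Module.End k V) v)
    rw [SetLike.val_smul, LinearMap.smul_apply]⟩
  -- complements
  refine ⟨fun p => ?_⟩
  have hstab : ∀ b ∈ B, ∀ v ∈ p.toSubmodule, b v ∈ p.toSubmodule := by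
    intro b hb
    induction hb using Algebra.adjoin_induction with
    | mem x hx =>
      obtain ⟨a, rfl⟩ := hx
      exact fun v hv => p.apply_mem_toSubmodule a hv
    | algebraMap c =>
      intro v hv
      rw [Module.algebraMap_end_apply]
      exact p.toSubmodule.smul_mem c hv
    | add x y _ _ hx' hy' =>
      intro v hv
      rw [LinearMap.add_apply]
      exact add_mem (hx' v hv) (hy' v hv)
    | mul x y _ _ hx' hy' =>
      intro v hv
      rw [Module.End.mul_apply]
      exact hx' _ (hy' v hv)
  let pB : Submodule B V :=
    { carrier := p.toSubmodule
      add_mem' := fun hv hw => p.toSubmodule.add_mem hv hw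
      zero_mem' := p.toSubmodule.zero_mem
      smul_mem' := fun b v hv => hstab b b.2 v hv }
  obtain ⟨qB, hq⟩ := exists_isCompl pB
  let q : Subrepresentation (ρ.toMonoidHom : Representation k E V) :=
    ⟨qB.restrictScalars k, fun a v hv => qB.smul_mem ⟨ρ a, Algebra.subset_adjoin ⟨a, rfl⟩⟩ hv⟩
  refine ⟨q, IsCompl.of_eq ?_ ?_⟩
  · apply Subrepresentation.toSubmodule_injective
    change p.toSubmodule ⊓ q.toSubmodule = ⊥
    rw [eq_bot_iff]
    intro v hv
    have hv' : v ∈ pB ⊓ qB := ⟨hv.1, hv.2⟩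
    rw [hq.inf_eq_bot] at hv'
    exact hv'
  · apply Subrepresentation.toSubmodule_injective
    change p.toSubmodule ⊔ q.toSubmodule = ⊤
    rw [eq_top_iff]
    intro v _
    have hv' : v ∈ pB ⊔ qB := by rw [hq.sup_eq_top]; exact Submodule.mem_top
    obtain ⟨x, hx, y, hy, rfl⟩ := Submodule.mem_sup.1 hv'
    exact Submodule.mem_sup.2 ⟨x, hx, y, hy, rfl⟩

end Semisimple

/-! ## §3 PROPOSITION 1.21, uniqueness clause: the module is determined by its traces -/

section Unique

variable {E : Type} [CommRing E] [Algebra ℚ E] [Module.Finite ℚ E] [IsReduced E]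
variable {k : Type} [Field k] [CharZero k]
variable {V W : Type} [AddCommGroup V] [Module k V] [FiniteDimensional k V]
  [AddCommGroup W] [Module k W] [FiniteDimensional k W]

/-- **PROPOSITION 1.21, uniqueness clause** («in which case `V` is uniquely determined up to an
`E ⊗_ℚ k`-isomorphism»), for `E` any reduced finite commutative `ℚ`-algebra — in particular a CM ALGEBRA — and
`k` any field of characteristic `0`: two finite-dimensional `k`-vector spaces with `k`-linear actions of `E` and
the same traces `Tr_k(a|V) = Tr_k(a|W)`, `a ∈ E`, are `E ⊗_ℚ k`-isomorphic.  Proof: both actions are semisimple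
(`isSemisimpleRepresentation_toMonoidHom`), and semisimple representations of the monoid `E` with equal characters
are equivalent — Bourbaki, *Algèbre* VIII §20 n°6, Cor. a) of Prop. 6, the tree's
`RepresentationTheory.Semisimple.Representation.nonempty_equiv_of_character_eq_of_isSemisimple`.
[cite: MilneCM2006, Ch. I §1 Prop. 1.21] [cite: BourbakiAlgebreVIII2012, VIII §20 n°6 Cor. a) de la Prop. 6] -/
theorem exists_equiv_of_trace_eq_of_isReduced (ρV : E →+* Module.End k V) (ρW : E →+* Module.End k W)
    (h : ∀ a : E, LinearMap.trace k V (ρV a) = LinearMap.trace k W (ρW a)) :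
    ∃ e : V ≃ₗ[k] W, ∀ (a : E) (v : V), e (ρV a v) = ρW a (e v) := by
  haveI := isSemisimpleRepresentation_toMonoidHom ρV
  haveI := isSemisimpleRepresentation_toMonoidHom ρW
  have hchar : Representation.character (ρV.toMonoidHom : Representation k E V) =
      Representation.character (ρW.toMonoidHom : Representation k E W) := funext fun a => h a
  obtain ⟨e⟩ := Literature.RepresentationTheory.Semisimple.Representation.nonempty_equiv_of_character_eq_of_isSemisimple
    (ρV.toMonoidHom : Representation k E V) (ρW.toMonoidHom : Representation k E W) hchar
  refine ⟨e.toLinearEquiv, fun a v => ?_⟩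
  have := LinearMap.congr_fun (e.isIntertwining' a) v
  simpa using this

end Unique

/-! ### CM algebras -/

section CMAlgebra

variable {E : Type} [CommRing E] [Algebra ℚ E]

/-- A CM algebra (a finite product of CM fields) is finite over `ℚ`. [cite: GaoUllmo2025, §2.1] -/
theorem _root_.Literature.AlgebraicGeometry.GaoUllmo2025.IsCMAlgebra.moduleFinite (hE : IsCMAlgebra E) :
    Module.Finite ℚ E := by
  obtain ⟨ι, _, K, _, _, _, ⟨e⟩⟩ := hE
  exact Module.Finite.equiv e.symm.toLinearEquiv

/-- A CM algebra (a finite product of CM fields) is reduced. [cite: GaoUllmo2025, §2.1] -/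
theorem _root_.Literature.AlgebraicGeometry.GaoUllmo2025.IsCMAlgebra.isReduced (hE : IsCMAlgebra E) : IsReduced E := by
  obtain ⟨ι, _, K, _, _, _, ⟨e⟩⟩ := hE
  exact isReduced_of_injective e e.injective

variable {k : Type} [Field k] [CharZero k]
variable {V W : Type} [AddCommGroup V] [Module k V] [FiniteDimensional k V]
  [AddCommGroup W] [Module k W] [FiniteDimensional k W]

/-- **PROPOSITION 1.21, uniqueness clause, for a CM-pair `(E, Φ)` with `E` a CM ALGEBRA**: a `k`-linear action
of `E` on a finite-dimensional `k`-space (`char k = 0`) is determined up to `E ⊗_ℚ k`-isomorphism by its traces.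
[cite: MilneCM2006, Ch. I §1 Prop. 1.21] -/
theorem exists_equiv_of_trace_eq_of_isCMAlgebra (hE : IsCMAlgebra E) (ρV : E →+* Module.End k V)
    (ρW : E →+* Module.End k W) (h : ∀ a : E, LinearMap.trace k V (ρV a) = LinearMap.trace k W (ρW a)) :
    ∃ e : V ≃ₗ[k] W, ∀ (a : E) (v : V), e (ρV a v) = ρW a (e v) := by
  haveI := hE.moduleFinite
  haveI := hE.isReduced
  exact exists_equiv_of_trace_eq_of_isReduced ρV ρW h

/-- **The `E ⊗_ℚ k`-module of Prop. 1.21 is unique**: over a subfield `k ⊂ ℂ`, two finite-dimensional `k`-spaces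
with `k`-linear actions of the CM algebra `E` both satisfying (5) `Tr_k(a|V) = Σ_{φ∈Φ} φ(a)` are
`E ⊗_ℚ k`-isomorphic («in which case `V` is uniquely determined up to an `E ⊗_ℚ k`-isomorphism»).
[cite: MilneCM2006, Ch. I §1 Prop. 1.21] -/
theorem exists_equiv_of_trace_eq_cmTraceOn (hE : IsCMAlgebra E) (Φ : CMTypeOn E) (k : IntermediateField ℚ ℂ)
    {V W : Type} [AddCommGroup V] [Module k V] [FiniteDimensional k V]
    [AddCommGroup W] [Module k W] [FiniteDimensional k W]
    (ρV : E →+* Module.End k V) (ρW : E →+* Module.End k W)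
    (hV : ∀ a : E, algebraMap k ℂ (LinearMap.trace k V (ρV a)) = cmTraceOn Φ a)
    (hW : ∀ a : E, algebraMap k ℂ (LinearMap.trace k W (ρW a)) = cmTraceOn Φ a) :
    ∃ e : V ≃ₗ[k] W, ∀ (a : E) (v : V), e (ρV a v) = ρW a (e v) :=
  exists_equiv_of_trace_eq_of_isCMAlgebra hE ρV ρW fun a =>
    (algebraMap k ℂ).injective (by rw [hV, hW])

/-- Over a number field `k ⊇ E*`, **every `E ⊗_ℚ k`-module satisfying (5) is isomorphic to the model
`V_Φ = ⊕_O k·φ_O(E)`** of `CMTypeTraceModule` («up to isomorphism, there exists exactly one `E ⊗_ℚ k`-module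
satisfying (5), namely, `⊕_{φ∈Φ} k_φ`»). [cite: MilneCM2006, Ch. I §1 Prop. 1.21] -/
theorem exists_equiv_traceModule [Module.Finite ℚ E] (hE : IsCMAlgebra E) (Φ : CMTypeOn E)
    (k : IntermediateField ℚ ℂ) [FiniteDimensional ℚ k] (hk : reflexFieldOn Φ ≤ k)
    {V : Type} [AddCommGroup V] [Module k V] [FiniteDimensional k V] (ρV : E →+* Module.End k V)
    (hV : ∀ a : E, algebraMap k ℂ (LinearMap.trace k V (ρV a)) = cmTraceOn Φ a) :
    ∃ e : V ≃ₗ[k] traceModule Φ k, ∀ (a : E) (v : V), e (ρV a v) = traceModuleAct Φ k a (e v) :=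
  exists_equiv_of_trace_eq_cmTraceOn hE Φ k ρV (traceModuleAct Φ k) hV (algebraMap_trace_traceModuleAct Φ k hk)

end CMAlgebra

end Literature.NumberTheory.ComplexMultiplication

end
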